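import Literature.Computability.Complexity.GateEliminationCase52

/-!
# Gate elimination: leaves of Case 5.4 of Li–Yang's Theorem 4.1

Finishing moves of Case 5.4 of §4.1 (ECCC TR21-023), stated over the local wiring (for the
dispatcher of Case 5.4 to invoke in the configuration its analysis produces). Everything PROVED.

* `stepGoal_trivialize_mid` — Case 5.4.1.2 (and `stepGoal_trivialize_reader` — Case 5.4.1.1.1,
  `exists_packing_removeGate_noNew` — Rule 1 without potential increase; see their docstrings): "If `D` is an ∧-type gate, we substitute constant
  value to `z` to trivialize `D`, and eliminate `D`, `G` and the two descendants of `D` in order.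
  Since the elimination of `G` will not cause potential increment and the other gates are removed by
  Rule 2 and Rule 3, we can see that `ΔΦ ≤ 3`, hence `Δμ ≥ 4 - 3α_φ + α_I ≥ δ`." Here: the ∧-type
  gate `D` reads the `1`-gate `G` and the unprotected variable `z`; `G` reads two `2`-variables
  `x, y` (so deleting the `0`-gate `G` creates no troubled gate); `D` has two readers. One
  substitution, `Δμ ≥ 4 - 2α_φ + α_I`.

## References

* J. Li, T. Yang, *3.1n − o(n) circuit lower bounds for explicit functions*, STOC 2022;
  ECCC TR21-023, §4.1 (Case 5.4.1.2), Lemma 3.11.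
-/

namespace Literature.Computability.Complexity

open Finset

namespace Semicircuit

variable {n : ℕ} {C : Semicircuit n} {f : (Fin n → ZMod 2) → Bool} {R : RdqSource n} {d : ℕ}
  {αφ αI αQ : ℝ}

/-- **Trivializing an ∧-type gate in the middle** (Case 5.4.1.2 of Li–Yang): `D` is ∧-type,
reads the `1`-gate `G` (at `aD`) and the variable `z` (unprotected); `G` reads the `2`-variables
`x` (at `aX`) and `y`, all three variables distinct; `F₁ ≠ F₂` read `D`. Then `z := c`
trivializing `D`, the eliminations of `D`, of the `0`-gate `G` (Rule 1, no potential increase),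
and of `F₁, F₂` (fed by constants) give `Δμ ≥ 4 - 2α_φ + α_I ≥ δ`, one substitution.
[cite: LiYang2022, §4.1 (Case 5.4.1.2), Lemma 3.11] -/
theorem stepGoal_trivialize_mid (hf : IsAffineDisperser f d) (hd : 2 * d + 2 < R.dim) (hF : C.Fair)
    (hC : C.ComputesRestr f R) (hS : C.Standing R) (hφ : 0 ≤ αφ) (hI : 0 ≤ αI) (αQ : ℝ)
    {G D F₁ F₂ : Fin C.m} {x y z : Fin n} {aX aD a₁ a₂ : Fin 2}
    (hGx : C.arg G aX = .var x) (hGy : C.arg G aX.rev = .var y) (hx2 : C.fanout (.var x) = 2) (hy2 : C.fanout (.var y) = 2)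
    (hG1 : C.fanout (.gate G) = 1)
    (hDand : IsAndOp (C.op D)) (hDG : C.arg D aD = .gate G) (hDz : C.arg D aD.rev = .var z)
    (hzx : z ≠ x) (hzy : z ≠ y)
    (hF₁ : C.arg F₁ a₁ = .gate D) (hF₂ : C.arg F₂ a₂ = .gate D) (hF12 : F₁ ≠ F₂) :
    C.StepGoal f R αφ αI αQ := by
  classical
  have hN := hS.normalized.1
  have hDK : D ∉ C.xorPart := C.not_mem_xorPart_of_isAndOp hDand
  have hGout : C.out ≠ .gate G := out_ne_of_read_bYacyclic hS hDK ⟨aD, hDG⟩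
  have hz : R.Free z := free_of_reads hC hDz
  have hzp : ¬ R.Protected z := fun hp => hS.protected_not_and z hp D aD.rev hDz hDand
  have hzinf : z ∈ C.influential R := C.mem_influential_of_reads R hDz
  have hxy : x ≠ y := by
    intro h; rw [← h] at hGy
    have e : ∀ a', C.arg G a' = .var x := fun a' => by
      rcases fin2_eq_or_eq_rev aX a' with e | e
      · rw [e]; exact hGx
      · rw [e]; exact hGy
    exact hN.arg_zero_ne_arg_one G (by rw [e 0, e 1])
  have hDG' : D ≠ G := fun h => by rw [h] at hDG; exact C.arg_ne_self_of_not_mem (h ▸ hDK) aD hDG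
  have hF₁D : F₁ ≠ D := fun h => by rw [h] at hF₁; exact C.arg_ne_self_of_not_mem hDK _ hF₁
  have hF₂D : F₂ ≠ D := fun h => by rw [h] at hF₂; exact C.arg_ne_self_of_not_mem hDK _ hF₂
  have hF₁G : F₁ ≠ G := by
    intro h; rw [h] at hF₁
    rcases fin2_eq_or_eq_rev aX a₁ with e | e
    · rw [e, hGx] at hF₁; cases hF₁
    · rw [e, hGy] at hF₁; cases hF₁
  have hF₂G : F₂ ≠ G := by
    intro h; rw [h] at hF₂
    rcases fin2_eq_or_eq_rev aX a₂ with e | e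
    · rw [e, hGx] at hF₂; cases hF₂
    · rw [e, hGy] at hF₂; cases hF₂
  -- the substitution `z := c` trivializing `D`
  obtain ⟨b, hb⟩ := exists_trivializing hDand aD.rev
  let c : ZMod 2 := finTwoEquiv.symm b
  have hbc : finTwoEquiv c = b := finTwoEquiv.apply_symm_apply b
  let C₁ := C.substConst z (finTwoEquiv c)
  let R₁ := R.assignFree z c hz hzp
  have hFa₁ : C₁.Fair := hF.substConst z _
  have hC₁ : C₁.ComputesRestr f R₁ := hC.substConst_assignFree hz hzp c
  have hP₁ : C₁.IsPacking (C.substConstPacking z (finTwoEquiv c) ∅) := C.isPacking_empty.substConst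
  have hd₁ : 2 * d + 2 ≤ R₁.dim := by
    have := RdqSource.dim_assignFree (b := c) hz hzp
    show 2 * d + 2 ≤ (R.assignFree z c hz hzp).dim; omega
  -- wires of `C₁`
  have hw : ∀ {k a}, C.arg k a ≠ .var z → C₁.arg k a = C.arg k a := by
    intro k a h
    show (C.arg k a).substConst z (finTwoEquiv c) = C.arg k a
    cases hv : C.arg k a with
    | const c' => rfl
    | var i => rw [hv] at h; exact Node.substConst_var_of_ne (fun hiz : i = z => h (by rw [hiz])) _
    | gate g => rfl
  have hDz₁ : C₁.arg D aD.rev = .const b := by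
    show (C.arg D aD.rev).substConst z (finTwoEquiv c) = _; rw [hDz, Node.substConst_var_self, hbc]
  have hDG₁ : C₁.arg D aD = .gate G := by rw [hw (by rw [hDG]; exact fun h => by cases h), hDG]
  have hGx₁ : C₁.arg G aX = .var x := by rw [hw (by rw [hGx]; exact fun h => hzx (Node.var.inj h).symm), hGx]
  have hGy₁ : C₁.arg G aX.rev = .var y := by rw [hw (by rw [hGy]; exact fun h => hzy (Node.var.inj h).symm), hGy]
  have hF₁₁ : C₁.arg F₁ a₁ = .gate D := by rw [hw (by rw [hF₁]; exact fun h => by cases h), hF₁]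
  have hF₂₁ : C₁.arg F₂ a₂ = .gate D := by rw [hw (by rw [hF₂]; exact fun h => by cases h), hF₂]
  have htriv : C₁.liveFn D aD.rev b false = C₁.liveFn D aD.rev b true := hb
  have hout₁ : C₁.out ≠ .gate D := out_ne_of_trivialized hf (by omega) hFa₁ hC₁ hDz₁ htriv
  -- step 1: eliminate `D`, introducing no troubled gate
  let E₁ := elimDataWTriv hFa₁ hC₁ hP₁ hDz₁ htriv hout₁ hφ hI αQ
  have hrepl : E₁.repl = .const (C₁.liveFn D aD.rev b false) := rfl
  obtain ⟨kG, hkG⟩ := E₁.ι_surj G hDG'.symm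
  have hGwires : ∀ a, C₁.arg (E₁.ι kG) a ≠ .gate D := by
    intro a h; rw [hkG] at h
    rcases fin2_eq_or_eq_rev aX a with e | e
    · rw [e, hGx₁] at h; cases h
    · rw [e, hGy₁] at h; cases h
  have hkG0 : E₁.C'.fanout (.gate kG) = 0 := by
    have h1 := E₁.fanout_gate_add (k' := kG) (by rw [hrepl]; exact fun h => by cases h)
    rw [hkG, C.fanout_substConst_gate, hG1] at h1
    have h2 : 1 ≤ (univ.filter fun a : Fin 2 => C₁.arg D a = .gate G).card :=
      card_pos.mpr ⟨aD, mem_filter.mpr ⟨mem_univ _, hDG₁⟩⟩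
    omega
  have hnonew₁ : ∀ k', E₁.C'.Troubled k' → ¬ C₁.Troubled (E₁.ι k') → False := by
    intro k' hT' hT
    obtain ⟨a, ha⟩ := E₁.causedBy_of_new_troubled k' hT' hT
    rcases fin2_eq_or_eq_rev aD a with e | e
    · rw [e, hDG₁] at ha
      rcases ha with ha | ⟨z', hz', -⟩
      · -- `k'` is `G`, now a `0`-gate
        have : E₁.ι k' = G := (Node.gate.inj ha).symm
        have hk : k' = kG := E₁.ι_injective (this.trans hkG.symm)
        rw [hk] at hT'
        have := hT'.2.1; rw [hkG0] at this; exact absurd this (by norm_num)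
      · cases hz'
    · rw [e, hDz₁] at ha; exact not_causedBy_const ha
  obtain ⟨P₁, hP₁', hpot₁⟩ := E₁.exists_packing_of_cover hP₁ ∅ ∅ (fun k' hT' hT => (hnonew₁ k' hT' hT).elim)
    (Or.inl (by simp)) (Or.inl (by simp))
  simp only [if_true, Nat.cast_zero, add_zero] at hpot₁
  -- step 2: delete the `0`-gate `G` (no potential increase: `x`, `y` become `1`-variables)
  have houtG : E₁.C'.out ≠ .gate kG := by
    intro h
    have := E₁.out_eq
    rw [h, if_neg hout₁] at this
    change Node.gate (E₁.ι kG) = C₁.out at this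
    rw [hkG] at this
    obtain ⟨ko, hko⟩ := exists_out_eq_gate' hf hF hC (by omega)
    have hC₁out : C₁.out = .gate ko := by show (C.out).substConst z (finTwoEquiv c) = _; rw [hko]; rfl
    rw [hC₁out] at this
    cases this
    exact hGout hko
  have hno : ∀ k a, E₁.C'.arg k a ≠ .gate kG := (fanout_eq_zero_iff _ _).mp hkG0
  let ε := E₁.C'.skipEquiv kG
  let C₂ := E₁.C'.removeGate kG ε
  have hFa₂ : C₂.Fair := E₁.fair.removeGate ε hno
  have hC₂ : C₂.ComputesRestr f R₁ := E₁.computes.removeGate ε E₁.fair hno houtG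
  have hkGx : E₁.C'.arg kG aX = .var x := by rw [E₁.arg_eq_var_iff, hkG]; exact Or.inl hGx₁
  have hkGy : E₁.C'.arg kG aX.rev = .var y := by rw [E₁.arg_eq_var_iff, hkG]; exact Or.inl hGy₁
  have hx₁ : E₁.C'.fanout (.var x) = 2 := by
    rw [E₁.fanout_var_eq (fun a h => ?_) (by rw [hrepl]; exact fun h => by cases h), C.fanout_substConst_var_of_ne z _ hzx.symm]
    · exact hx2
    · rcases fin2_eq_or_eq_rev aD a with e | e
      · rw [e, hDG₁] at h; cases h
      · rw [e, hDz₁] at h; cases h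
  have hy₁ : E₁.C'.fanout (.var y) = 2 := by
    rw [E₁.fanout_var_eq (fun a h => ?_) (by rw [hrepl]; exact fun h => by cases h), C.fanout_substConst_var_of_ne z _ hzy.symm]
    · exact hy2
    · rcases fin2_eq_or_eq_rev aD a with e | e
      · rw [e, hDG₁] at h; cases h
      · rw [e, hDz₁] at h; cases h
  have hx₂ : C₂.fanout (.var x) ≤ 1 := by
    have h1 := E₁.C'.fanout_removeGate_add kG ε hno (v := .var x) (fun h => by cases h)
    have h2 : 1 ≤ (univ.filter fun a : Fin 2 => E₁.C'.arg kG a = .var x).card :=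
      card_pos.mpr ⟨aX, mem_filter.mpr ⟨mem_univ _, hkGx⟩⟩
    change C₂.fanout (.var x) + _ = _ at h1
    omega
  have hy₂ : C₂.fanout (.var y) ≤ 1 := by
    have h1 := E₁.C'.fanout_removeGate_add kG ε hno (v := .var y) (fun h => by cases h)
    have h2 : 1 ≤ (univ.filter fun a : Fin 2 => E₁.C'.arg kG a = .var y).card :=
      card_pos.mpr ⟨aX.rev, mem_filter.mpr ⟨mem_univ _, hkGy⟩⟩
    change C₂.fanout (.var y) + _ = _ at h1
    omega
  have hcov : ∀ k, C₂.Troubled k → ¬ E₁.C'.Troubled ((ε k : Fin E₁.C'.m)) → k ∈ (∅ : Finset _) ∨ k ∈ (∅ : Finset _) := by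
    -- a new troubled gate would read `x` or `y`, now `≤ 1`-variables
    intro k hT' hT
    exfalso
    obtain ⟨a, ha⟩ := E₁.C'.causedBy_of_new_troubled_removeGate kG ε hno hT' hT
    have key : ∀ v, E₁.C'.arg kG a = .var v → C₂.fanout (.var v) ≤ 1 → False := by
      intro v hv hle
      rw [hv] at ha
      rcases ha with ha | ⟨z', hz', a', ha'⟩
      · cases ha
      · cases hz'
        obtain ⟨-, -, x', y', -, hr, hx', hy'⟩ := hT'
        have hmem : (Node.var v : Node n _) ∈ Set.range (C₂.arg k) := ⟨a', ha'⟩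
        rw [hr] at hmem
        rcases hmem with h | h
        · cases h; change C₂.fanout _ = 2 at hx'; omega
        · cases h; change C₂.fanout _ = 2 at hy'; omega
    rcases fin2_eq_or_eq_rev aX a with e | e
    · exact key x (by rw [e]; exact hkGx) hx₂
    · exact key y (by rw [e]; exact hkGy) hy₂
  obtain ⟨P₂, hP₂, hpot₂⟩ := exists_packing_transfer' E₁.C' C₂ (fun k => (ε k : Fin E₁.C'.m))
    (fun a b h => ε.injective (Subtype.ext h)) hP₁'
    (fun k k' _ _ _ _ h => E₁.C'.adjacent_removeGate_of kG ε k k' h) ∅ ∅ hcov (Or.inl (by simp)) (Or.inl (by simp))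
  simp only [if_true, Nat.cast_zero, add_zero] at hpot₂
  -- step 3: `F₁`, `F₂` are fed by constants in `C₂`
  obtain ⟨k₁, hk₁⟩ := E₁.ι_surj F₁ hF₁D
  obtain ⟨k₂, hk₂⟩ := E₁.ι_surj F₂ hF₂D
  have hk₁c : E₁.C'.arg k₁ a₁ = .const (C₁.liveFn D aD.rev b false) :=
    (E₁.arg_eq_const_iff k₁ a₁ _).mpr (Or.inr ⟨by rw [hk₁]; exact hF₁₁, hrepl⟩)
  have hk₂c : E₁.C'.arg k₂ a₂ = .const (C₁.liveFn D aD.rev b false) :=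
    (E₁.arg_eq_const_iff k₂ a₂ _).mpr (Or.inr ⟨by rw [hk₂]; exact hF₂₁, hrepl⟩)
  have hk₁G : k₁ ≠ kG := fun h => hF₁G (by rw [← hk₁, ← hkG, h])
  have hk₂G : k₂ ≠ kG := fun h => hF₂G (by rw [← hk₂, ← hkG, h])
  have hk₁₂ : k₁ ≠ k₂ := fun h => hF12 (by rw [← hk₁, ← hk₂, h])
  have hcount : 2 ≤ C₂.constFedCount := by
    unfold constFedCount
    have hmem : ∀ {k : Fin E₁.C'.m} (hk : k ≠ kG) {a : Fin 2} {b' : Bool}, E₁.C'.arg k a = .const b' →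
        ε.symm ⟨k, hk⟩ ∈ univ.filter fun k => ∃ a b', C₂.arg k a = .const b' := by
      intro k hk a b' h
      refine mem_filter.mpr ⟨mem_univ _, a, b', ?_⟩
      show (E₁.C'.arg (ε (ε.symm ⟨k, hk⟩)) a).skip kG ε = .const b'
      rw [Equiv.apply_symm_apply ε]
      show (E₁.C'.arg k a).skip kG ε = .const b'
      rw [h]; rfl
    have hsub : ({ε.symm ⟨k₁, hk₁G⟩, ε.symm ⟨k₂, hk₂G⟩} : Finset _) ⊆
        univ.filter fun k => ∃ a b', C₂.arg k a = .const b' := by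
      intro k hk
      rw [mem_insert, mem_singleton] at hk
      rcases hk with rfl | rfl
      · exact hmem hk₁G hk₁c
      · exact hmem hk₂G hk₂c
    have hne : ε.symm ⟨k₁, hk₁G⟩ ≠ ε.symm ⟨k₂, hk₂G⟩ := fun h => hk₁₂ (by
      have := congrArg Subtype.val (ε.symm.injective h); exact this)
    have := card_le_card hsub
    rwa [card_pair hne] at this
  obtain ⟨D', P', hF', hCD', hP', hm', hμ'⟩ := cascade hf hd₁ hφ hI αQ 2 C₂ P₂ hFa₂ hC₂ hP₂ hcount
  -- accounting
  refine stepGoal_of_stepBranch2 (stepBranch2_of_assignFree_gain hφ hI hz hzp c C.isPacking_empty hzinf (4 - 2 * αφ) ?_ hF' hCD' hP' ?_)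
  · have := liYangDelta_le_case3 αφ αI αQ; linarith
  · have hinf₂ : ((C₂.influential R₁).card : ℝ) ≤ (C₁.influential R₁).card := by
      have h1 := E₁.C'.influential_removeGate_subset kG ε hno R₁
      have h2 := E₁.influential_subset R₁
      exact_mod_cast card_le_card (h1.trans h2)
    have hm₁ : E₁.C'.m + 1 = C.m := E₁.m_add_one
    have hm₂ := E₁.C'.removeGate_m_add_one kG ε
    have hmC₂ : (C₂.m : ℝ) + 2 = C₁.m := by
      have : C₂.m + 2 = C.m := by change (E₁.C'.m - 1) + 2 = C.m; omega
      exact_mod_cast this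
    have hμ₂ : C₂.measure αφ αI αQ P₂ R₁ ≤
        C₁.measure αφ αI αQ (C.substConstPacking z (finTwoEquiv c) ∅) R₁ - 2 := by
      unfold measure
      have hp : (C₂.potential P₂ : ℝ) ≤ C₁.potential (C.substConstPacking z (finTwoEquiv c) ∅) := by linarith
      nlinarith [mul_le_mul_of_nonneg_left hinf₂ hI, mul_le_mul_of_nonneg_left hp hφ]
    push_cast at hμ'
    linarith

/-- **Deleting a `0`-gate without potential increase**: if every variable wire of the deleted gate
had out-degree `≤ 2` and every gate wire out-degree `≤ 1`, no troubled gate appears (their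
out-degrees drop), so a packing survives with no larger potential. [cite: LiYang2022, Lemma 3.11 (Rule 1)] -/
theorem exists_packing_removeGate_noNew (D : Semicircuit n) (k₀ : Fin D.m) {m' : ℕ}
    (ε : Fin m' ≃ {k : Fin D.m // k ≠ k₀}) (h0 : ∀ k a, D.arg k a ≠ .gate k₀)
    {P : Finset (Fin D.m × Fin D.m)} (hP : D.IsPacking P)
    (hvar : ∀ a v, D.arg k₀ a = .var v → D.fanout (.var v) ≤ 2)
    (hgate : ∀ a g, D.arg k₀ a = .gate g → D.fanout (.gate g) ≤ 1) :
    ∃ P' : Finset (Fin m' × Fin m'), (D.removeGate k₀ ε).IsPacking P' ∧ (D.removeGate k₀ ε).potential P' ≤ D.potential P := by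
  classical
  have hcov : ∀ k, (D.removeGate k₀ ε).Troubled k → ¬ D.Troubled ((ε k : Fin D.m)) →
      k ∈ (∅ : Finset _) ∨ k ∈ (∅ : Finset _) := by
    intro k hT' hT
    exfalso
    obtain ⟨a, ha⟩ := D.causedBy_of_new_troubled_removeGate k₀ ε h0 hT' hT
    cases hka : D.arg k₀ a with
    | const c => rw [hka] at ha; exact not_causedBy_const ha
    | gate g =>
      rw [hka] at ha
      rcases ha with ha | ⟨z, hz, -⟩
      · have hkg : (ε k : Fin D.m) = g := (Node.gate.inj ha).symm
        have h1 := D.fanout_removeGate_add k₀ ε h0 (v := .gate g) (fun h => by cases h; exact h0 k₀ a hka)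
        have h2 : 1 ≤ (univ.filter fun a' : Fin 2 => D.arg k₀ a' = .gate g).card :=
          card_pos.mpr ⟨a, mem_filter.mpr ⟨mem_univ _, hka⟩⟩
        have h3 := hgate a g hka
        have hskip : (Node.gate g : Node n D.m).skip k₀ ε = .gate k := by
          rw [← hkg]; exact Node.skip_gate_coe k₀ ε k
        rw [hskip] at h1
        have := hT'.2.1
        omega
      · cases hz
    | var v =>
      rw [hka] at ha
      rcases ha with ha | ⟨z, hz, a', ha'⟩
      · cases ha
      · cases hz
        have h1 := D.fanout_removeGate_add k₀ ε h0 (v := .var v) (fun h => by cases h)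
        have h2 : 1 ≤ (univ.filter fun a'' : Fin 2 => D.arg k₀ a'' = .var v).card :=
          card_pos.mpr ⟨a, mem_filter.mpr ⟨mem_univ _, hka⟩⟩
        have h3 := hvar a v hka
        obtain ⟨-, -, x', y', -, hr, hx', hy'⟩ := hT'
        have hmem : (Node.var v : Node n _) ∈ Set.range ((D.removeGate k₀ ε).arg k) := ⟨a', ha'⟩
        rw [hr] at hmem
        change (D.removeGate k₀ ε).fanout (.var v) + _ = _ at h1
        rcases hmem with h | h
        · cases h; omega
        · cases h; omega
  have := exists_packing_transfer' D (D.removeGate k₀ ε) (fun k => (ε k : Fin D.m))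
    (fun a b h => ε.injective (Subtype.ext h)) hP
    (fun k k' _ _ _ _ h => D.adjacent_removeGate_of k₀ ε k k' h) ∅ ∅ hcov (Or.inl (by simp)) (Or.inl (by simp))
  simpa using this

/-- **Trivializing the reader of `D`** (Case 5.4.1.1.1 of Li–Yang: "we substitute a constant to
`t` so that `E` is trivialized, and eliminate `E`, `D`, `G` and the descendant of `E` in order …
`ΔΦ ≤ 1` … Hence `Δμ ≥ 4 - α_φ + α_I ≥ δ`"): the ∧-type `1`-gate `E` reads the `1`-gate `D` (at
`aE`) and the variable `t`; `D` reads the `1`-gate `G` (at `aD`) and the `≤ 2`-variable `u`;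
`G` reads the `≤ 2`-variables `x` (at `aX`) and `y`; `t ∉ {x, y, u}`; `H` reads `E`. One
substitution, `Δμ ≥ 4 - α_φ + α_I`. [cite: LiYang2022, §4.1 (Case 5.4.1.1.1), Lemma 3.11] -/
theorem stepGoal_trivialize_reader (hf : IsAffineDisperser f d) (hd : 2 * d + 2 < R.dim) (hF : C.Fair)
    (hC : C.ComputesRestr f R) (hS : C.Standing R) (hφ : 0 ≤ αφ) (hI : 0 ≤ αI) (αQ : ℝ)
    {G D E H : Fin C.m} {x y u t : Fin n} {aX aD aE aH : Fin 2}
    (hGx : C.arg G aX = .var x) (hGy : C.arg G aX.rev = .var y) (hx2 : C.fanout (.var x) ≤ 2) (hy2 : C.fanout (.var y) ≤ 2)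
    (hG1 : C.fanout (.gate G) = 1)
    (hDG : C.arg D aD = .gate G) (hDu : C.arg D aD.rev = .var u) (hu2 : C.fanout (.var u) ≤ 2) (hD1 : C.fanout (.gate D) = 1)
    (hEand : IsAndOp (C.op E)) (hED : C.arg E aE = .gate D) (hEt : C.arg E aE.rev = .var t) (hE1 : C.fanout (.gate E) = 1)
    (htx : t ≠ x) (hty : t ≠ y) (htu : t ≠ u)
    (hHE : C.arg H aH = .gate E) (hGand : IsAndOp (C.op G)) :
    C.StepGoal f R αφ αI αQ := by
  classical
  have hN := hS.normalized.1
  have hEK : E ∉ C.xorPart := C.not_mem_xorPart_of_isAndOp hEand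
  have hGK : G ∉ C.xorPart := C.not_mem_xorPart_of_isAndOp hGand
  have hDK : D ∉ C.xorPart := fun hDK => hGK (C.mem_of_arg_eq D hDK aD G hDG)
  have hDout : C.out ≠ .gate D := out_ne_of_read_bYacyclic hS hEK ⟨aE, hED⟩
  have hGout : C.out ≠ .gate G := out_ne_of_read_bYacyclic hS hDK ⟨aD, hDG⟩
  have ht : R.Free t := free_of_reads hC hEt
  have htp : ¬ R.Protected t := fun hp => hS.protected_not_and t hp E aE.rev hEt hEand
  have htinf : t ∈ C.influential R := C.mem_influential_of_reads R hEt
  have hED' : E ≠ D := fun h => by rw [h] at hED; exact C.arg_ne_self_of_not_mem hDK _ hED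
  have hDG' : D ≠ G := fun h => by rw [h] at hDG; exact C.arg_ne_self_of_not_mem hGK _ hDG
  have hEG : E ≠ G := by
    intro h; rw [h] at hED
    rcases fin2_eq_or_eq_rev aX aE with e' | e'
    · rw [e', hGx] at hED; cases hED
    · rw [e', hGy] at hED; cases hED
  have hHE' : H ≠ E := fun h => by rw [h] at hHE; exact C.arg_ne_self_of_not_mem hEK _ hHE
  have hHD : H ≠ D := by
    intro h; rw [h] at hHE
    rcases fin2_eq_or_eq_rev aD aH with e' | e'
    · rw [e', hDG] at hHE; cases hHE; exact hEG rfl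
    · rw [e', hDu] at hHE; cases hHE
  have hHG : H ≠ G := by
    intro h; rw [h] at hHE
    rcases fin2_eq_or_eq_rev aX aH with e' | e'
    · rw [e', hGx] at hHE; cases hHE
    · rw [e', hGy] at hHE; cases hHE
  -- readers: only `E` reads `D`, only `D` reads `G`
  have hreadD : ∀ k a, C.arg k a = .gate D → k = E := by
    intro k a h; by_contra hk; have := two_le_fanout h hED hk; omega
  have hreadG : ∀ k a, C.arg k a = .gate G → k = D := by
    intro k a h; by_contra hk; have := two_le_fanout h hDG hk; omega
  -- the substitution `t := c` trivializing `E`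
  obtain ⟨b, hb⟩ := exists_trivializing hEand aE.rev
  let c : ZMod 2 := finTwoEquiv.symm b
  have hbc : finTwoEquiv c = b := finTwoEquiv.apply_symm_apply b
  let C₁ := C.substConst t (finTwoEquiv c)
  let R₁ := R.assignFree t c ht htp
  have hFa₁ : C₁.Fair := hF.substConst t _
  have hC₁ : C₁.ComputesRestr f R₁ := hC.substConst_assignFree ht htp c
  have hP₁ : C₁.IsPacking (C.substConstPacking t (finTwoEquiv c) ∅) := C.isPacking_empty.substConst
  have hd₁ : 2 * d + 2 ≤ R₁.dim := by
    have := RdqSource.dim_assignFree (b := c) ht htp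
    show 2 * d + 2 ≤ (R.assignFree t c ht htp).dim; omega
  have hw : ∀ {k a}, C.arg k a ≠ .var t → C₁.arg k a = C.arg k a := by
    intro k a h
    show (C.arg k a).substConst t (finTwoEquiv c) = C.arg k a
    cases hv : C.arg k a with
    | const c' => rfl
    | var i => rw [hv] at h; exact Node.substConst_var_of_ne (fun hit : i = t => h (by rw [hit])) _
    | gate g => rfl
  have hgate₁ : ∀ {k a g}, C₁.arg k a = .gate g ↔ C.arg k a = .gate g := by
    intro k a g
    show (C.arg k a).substConst t (finTwoEquiv c) = .gate g ↔ _
    cases hv : C.arg k a with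
    | const c' => exact ⟨(fun h => by cases h), fun h => by cases h⟩
    | var i =>
      by_cases hit : i = t
      · rw [hit, Node.substConst_var_self]; exact ⟨(fun h => by cases h), fun h => by cases h⟩
      · rw [Node.substConst_var_of_ne hit]
    | gate g' => exact Iff.rfl
  have hEt₁ : C₁.arg E aE.rev = .const b := by
    show (C.arg E aE.rev).substConst t (finTwoEquiv c) = _; rw [hEt, Node.substConst_var_self, hbc]
  have hED₁ : C₁.arg E aE = .gate D := by rw [hw (by rw [hED]; exact fun h => by cases h), hED]
  have hDG₁ : C₁.arg D aD = .gate G := by rw [hw (by rw [hDG]; exact fun h => by cases h), hDG]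
  have hDu₁ : C₁.arg D aD.rev = .var u := by rw [hw (by rw [hDu]; exact fun h => htu (Node.var.inj h).symm), hDu]
  have hGx₁ : C₁.arg G aX = .var x := by rw [hw (by rw [hGx]; exact fun h => htx (Node.var.inj h).symm), hGx]
  have hGy₁ : C₁.arg G aX.rev = .var y := by rw [hw (by rw [hGy]; exact fun h => hty (Node.var.inj h).symm), hGy]
  have hHE₁ : C₁.arg H aH = .gate E := by rw [hw (by rw [hHE]; exact fun h => by cases h), hHE]
  have htriv : C₁.liveFn E aE.rev b false = C₁.liveFn E aE.rev b true := hb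
  have hout₁ : C₁.out ≠ .gate E := out_ne_of_trivialized hf (by omega) hFa₁ hC₁ hEt₁ htriv
  obtain ⟨ko, hko⟩ := exists_out_eq_gate' hf hF hC (by omega)
  have hC₁out : C₁.out = .gate ko := by show (C.out).substConst t (finTwoEquiv c) = _; rw [hko]; rfl
  -- step 1: eliminate `E`
  let E₁ := elimDataWTriv hFa₁ hC₁ hP₁ hEt₁ htriv hout₁ hφ hI αQ
  have hrepl : E₁.repl = .const (C₁.liveFn E aE.rev b false) := rfl
  obtain ⟨kD, hkD⟩ := E₁.ι_surj D hED'.symm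
  obtain ⟨kG, hkG⟩ := E₁.ι_surj G hEG.symm
  obtain ⟨kH, hkH⟩ := E₁.ι_surj H hHE'
  have hkD0 : E₁.C'.fanout (.gate kD) = 0 := by
    have h1 := E₁.fanout_gate_add (k' := kD) (by rw [hrepl]; exact fun h => by cases h)
    rw [hkD, C.fanout_substConst_gate, hD1] at h1
    have h2 : 1 ≤ (univ.filter fun a : Fin 2 => C₁.arg E a = .gate D).card :=
      card_pos.mpr ⟨aE, mem_filter.mpr ⟨mem_univ _, hED₁⟩⟩
    omega
  have hkG1 : E₁.C'.fanout (.gate kG) = 1 := by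
    rw [E₁.fanout_gate_eq (fun a h => ?_) (by rw [hrepl]; exact fun h => by cases h), hkG, C.fanout_substConst_gate, hG1]
    rw [hkG] at h
    exact hED' (hreadG E a (hgate₁.mp h))
  have hnonew₁ : ∀ k', E₁.C'.Troubled k' → ¬ C₁.Troubled (E₁.ι k') → False := by
    intro k' hT' hT
    obtain ⟨a, ha⟩ := E₁.causedBy_of_new_troubled k' hT' hT
    rcases fin2_eq_or_eq_rev aE a with e' | e'
    · rw [e', hED₁] at ha
      rcases ha with ha | ⟨z', hz', -⟩
      · have : E₁.ι k' = D := (Node.gate.inj ha).symm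
        have hk : k' = kD := E₁.ι_injective (this.trans hkD.symm)
        rw [hk] at hT'
        have := hT'.2.1; rw [hkD0] at this; exact absurd this (by norm_num)
      · cases hz'
    · rw [e', hEt₁] at ha; exact not_causedBy_const ha
  obtain ⟨P₁, hP₁', hpot₁⟩ := E₁.exists_packing_of_cover hP₁ ∅ ∅ (fun k' hT' hT => (hnonew₁ k' hT' hT).elim)
    (Or.inl (by simp)) (Or.inl (by simp))
  simp only [if_true, Nat.cast_zero, add_zero] at hpot₁
  -- wires after step 1
  have hkDG : E₁.C'.arg kD aD = .gate kG := by rw [E₁.arg_eq_gate_iff, hkD, hkG]; exact Or.inl hDG₁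
  have hkDu : E₁.C'.arg kD aD.rev = .var u := by rw [E₁.arg_eq_var_iff, hkD]; exact Or.inl hDu₁
  have hkGx : E₁.C'.arg kG aX = .var x := by rw [E₁.arg_eq_var_iff, hkG]; exact Or.inl hGx₁
  have hkGy : E₁.C'.arg kG aX.rev = .var y := by rw [E₁.arg_eq_var_iff, hkG]; exact Or.inl hGy₁
  have hkHc : E₁.C'.arg kH aH = .const (C₁.liveFn E aE.rev b false) :=
    (E₁.arg_eq_const_iff kH aH _).mpr (Or.inr ⟨by rw [hkH]; exact hHE₁, hrepl⟩)
  have hvarfan₁ : ∀ {v}, v ≠ t → E₁.C'.fanout (.var v) ≤ C.fanout (.var v) := by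
    intro v hvt
    have h1 := E₁.fanout_var_add (i := v) (by rw [hrepl]; exact fun h => by cases h)
    rw [C.fanout_substConst_var_of_ne t _ hvt] at h1
    omega
  have hout₁' : E₁.C'.out ≠ .gate kD := by
    intro h
    have := E₁.out_eq
    rw [h, if_neg hout₁, hC₁out] at this
    change Node.gate (E₁.ι kD) = Node.gate ko at this
    rw [hkD] at this; cases this; exact hDout hko
  have hout₁'' : E₁.C'.out ≠ .gate kG := by
    intro h
    have := E₁.out_eq
    rw [h, if_neg hout₁, hC₁out] at this
    change Node.gate (E₁.ι kG) = Node.gate ko at this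
    rw [hkG] at this; cases this; exact hGout hko
  -- step 2: delete the `0`-gate `D`
  have hno₂ : ∀ k a, E₁.C'.arg k a ≠ .gate kD := (fanout_eq_zero_iff _ _).mp hkD0
  let ε₂ := E₁.C'.skipEquiv kD
  let C₂ := E₁.C'.removeGate kD ε₂
  have hFa₂ : C₂.Fair := E₁.fair.removeGate ε₂ hno₂
  have hC₂ : C₂.ComputesRestr f R₁ := E₁.computes.removeGate ε₂ E₁.fair hno₂ hout₁'
  have hvar₂ : ∀ a v, E₁.C'.arg kD a = .var v → E₁.C'.fanout (.var v) ≤ 2 := by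
    intro a v hv
    rcases fin2_eq_or_eq_rev aD a with e' | e'
    · rw [e', hkDG] at hv; cases hv
    · rw [e', hkDu] at hv; cases hv; exact (hvarfan₁ (fun h => htu h.symm)).trans hu2
  have hgate₂ : ∀ a g, E₁.C'.arg kD a = .gate g → E₁.C'.fanout (.gate g) ≤ 1 := by
    intro a g hg
    rcases fin2_eq_or_eq_rev aD a with e' | e'
    · rw [e', hkDG] at hg; cases hg; omega
    · rw [e', hkDu] at hg; cases hg
  obtain ⟨P₂, hP₂, hpot₂⟩ := exists_packing_removeGate_noNew E₁.C' kD ε₂ hno₂ hP₁' hvar₂ hgate₂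
  -- `G` and `H` in `C₂`
  have hkGD : kG ≠ kD := fun h => hDG' (by rw [← hkD, ← hkG, h])
  have hkHD : kH ≠ kD := fun h => hHD (by rw [← hkH, ← hkD, h])
  let kG₂ : Fin _ := ε₂.symm ⟨kG, hkGD⟩
  let kH₂ : Fin _ := ε₂.symm ⟨kH, hkHD⟩
  have hεG : (ε₂ kG₂ : Fin E₁.C'.m) = kG := by show ((ε₂ (ε₂.symm ⟨kG, hkGD⟩)) : Fin E₁.C'.m) = kG; rw [Equiv.apply_symm_apply ε₂]
  have hεH : (ε₂ kH₂ : Fin E₁.C'.m) = kH := by show ((ε₂ (ε₂.symm ⟨kH, hkHD⟩)) : Fin E₁.C'.m) = kH; rw [Equiv.apply_symm_apply ε₂]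
  have hG₂0 : C₂.fanout (.gate kG₂) = 0 := by
    have h1 := E₁.C'.fanout_removeGate_add kD ε₂ hno₂ (v := .gate kG) (fun h => hkGD (Node.gate.inj h))
    have hskip : (Node.gate kG : Node n E₁.C'.m).skip kD ε₂ = .gate kG₂ := Node.skip_gate_of_ne kD ε₂ hkGD
    rw [hskip, hkG1] at h1
    have h2 : 1 ≤ (univ.filter fun a : Fin 2 => E₁.C'.arg kD a = .gate kG).card :=
      card_pos.mpr ⟨aD, mem_filter.mpr ⟨mem_univ _, hkDG⟩⟩
    change C₂.fanout (.gate kG₂) + _ = _ at h1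
    omega
  have hG₂x : C₂.arg kG₂ aX = .var x := by
    show (E₁.C'.arg (ε₂ kG₂) aX).skip kD ε₂ = .var x; rw [hεG, hkGx]; rfl
  have hG₂y : C₂.arg kG₂ aX.rev = .var y := by
    show (E₁.C'.arg (ε₂ kG₂) aX.rev).skip kD ε₂ = .var y; rw [hεG, hkGy]; rfl
  have hH₂c : C₂.arg kH₂ aH = .const (C₁.liveFn E aE.rev b false) := by
    show (E₁.C'.arg (ε₂ kH₂) aH).skip kD ε₂ = _; rw [hεH, hkHc]; rfl
  have hout₂ : C₂.out ≠ .gate kG₂ := by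
    intro h
    change E₁.C'.out.skip kD ε₂ = .gate kG₂ at h
    rw [Node.skip_eq_gate_iff] at h
    rw [hεG] at h
    exact hout₁'' h
  have hvarfan₂ : ∀ v, C₂.fanout (.var v) ≤ E₁.C'.fanout (.var v) := by
    intro v
    have h1 := E₁.C'.fanout_removeGate_add kD ε₂ hno₂ (v := .var v) (fun h => by cases h)
    change C₂.fanout (.var v) + _ = _ at h1
    omega
  -- step 3: delete the `0`-gate `G`
  have hno₃ : ∀ k a, C₂.arg k a ≠ .gate kG₂ := (fanout_eq_zero_iff _ _).mp hG₂0
  let ε₃ := C₂.skipEquiv kG₂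
  let C₃ := C₂.removeGate kG₂ ε₃
  have hFa₃ : C₃.Fair := hFa₂.removeGate ε₃ hno₃
  have hC₃ : C₃.ComputesRestr f R₁ := hC₂.removeGate ε₃ hFa₂ hno₃ hout₂
  have hvar₃ : ∀ a v, C₂.arg kG₂ a = .var v → C₂.fanout (.var v) ≤ 2 := by
    intro a v hv
    rcases fin2_eq_or_eq_rev aX a with e' | e'
    · rw [e', hG₂x] at hv; cases hv
      exact (hvarfan₂ x).trans ((hvarfan₁ (fun h => htx h.symm)).trans hx2)
    · rw [e', hG₂y] at hv; cases hv
      exact (hvarfan₂ y).trans ((hvarfan₁ (fun h => hty h.symm)).trans hy2)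
  have hgate₃ : ∀ a g, C₂.arg kG₂ a = .gate g → C₂.fanout (.gate g) ≤ 1 := by
    intro a g hg
    rcases fin2_eq_or_eq_rev aX a with e' | e'
    · rw [e', hG₂x] at hg; cases hg
    · rw [e', hG₂y] at hg; cases hg
  obtain ⟨P₃, hP₃, hpot₃⟩ := exists_packing_removeGate_noNew C₂ kG₂ ε₃ hno₃ hP₂ hvar₃ hgate₃
  -- step 4: `H` is fed by a constant in `C₃`
  have hkHG₂ : kH₂ ≠ kG₂ := by
    intro h
    have : (ε₂ kH₂ : Fin E₁.C'.m) = (ε₂ kG₂ : Fin E₁.C'.m) := by rw [h]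
    rw [hεH, hεG] at this
    exact hHG (by rw [← hkH, ← hkG, this])
  have hcount : 1 ≤ C₃.constFedCount := by
    unfold constFedCount
    refine card_pos.mpr ⟨ε₃.symm ⟨kH₂, hkHG₂⟩, mem_filter.mpr ⟨mem_univ _, aH, C₁.liveFn E aE.rev b false, ?_⟩⟩
    show (C₂.arg (ε₃ (ε₃.symm ⟨kH₂, hkHG₂⟩)) aH).skip kG₂ ε₃ = .const (C₁.liveFn E aE.rev b false)
    rw [Equiv.apply_symm_apply ε₃]
    show (C₂.arg kH₂ aH).skip kG₂ ε₃ = _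
    rw [hH₂c]; rfl
  obtain ⟨D', P', hF', hCD', hP', hm', hμ'⟩ := cascade hf hd₁ hφ hI αQ 1 C₃ P₃ hFa₃ hC₃ hP₃ hcount
  -- accounting
  refine stepGoal_of_stepBranch2 (stepBranch2_of_assignFree_gain hφ hI ht htp c C.isPacking_empty htinf (4 - αφ) ?_ hF' hCD' hP' ?_)
  · have := liYangDelta_le_case3 αφ αI αQ; linarith
  · have hinf₃ : ((C₃.influential R₁).card : ℝ) ≤ (C₁.influential R₁).card := by
      have h1 := C₂.influential_removeGate_subset kG₂ ε₃ hno₃ R₁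
      have h2 := E₁.C'.influential_removeGate_subset kD ε₂ hno₂ R₁
      have h3 := E₁.influential_subset R₁
      exact_mod_cast card_le_card (h1.trans (h2.trans h3))
    have hm₁ : E₁.C'.m + 1 = C.m := E₁.m_add_one
    have hm₂ := E₁.C'.removeGate_m_add_one kD ε₂
    have hm₃ := C₂.removeGate_m_add_one kG₂ ε₃
    have hmC₃ : (C₃.m : ℝ) + 3 = C₁.m := by
      have : C₃.m + 3 = C.m := by
        change (E₁.C'.m - 1 - 1) + 3 = C.m
        omega
      exact_mod_cast this
    have hμ₃ : C₃.measure αφ αI αQ P₃ R₁ ≤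
        C₁.measure αφ αI αQ (C.substConstPacking t (finTwoEquiv c) ∅) R₁ - 3 := by
      unfold measure
      have hp : (C₃.potential P₃ : ℝ) ≤ C₁.potential (C.substConstPacking t (finTwoEquiv c) ∅) := by
        have e2 : (C₂.potential P₂ : ℝ) ≤ E₁.C'.potential P₁ := by exact_mod_cast hpot₂
        have e3 : (C₃.potential P₃ : ℝ) ≤ C₂.potential P₂ := by exact_mod_cast hpot₃
        linarith
      nlinarith [mul_le_mul_of_nonneg_left hinf₃ hI, mul_le_mul_of_nonneg_left hp hφ]
    push_cast at hμ'
    linarith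

end Semicircuit

end Literature.Computability.Complexity
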